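import Summits.MatrixMultiplication.MatrixMultiplication.Theorems.SaturationLadderVertexGerm
import Summits.MatrixMultiplication.MatrixMultiplication.Theorems.SaturationLadderFamilyConstant
import Summits.MatrixMultiplication.MatrixMultiplication.Theorems.SaturationLadderExpSaturation
import HarnessLib

/-!
# SaturationLadder on Strassen's spectrum, II: landed grades, the crux as a collar statement, flat dark points

Support module (def-free, sorry-free) for route `SaturationLadder`, crux `SubexpSaturation`
(stmt-MatrixMultiplication-25909) and the residual `SquareFromTwo` (stmt-29475); continues Part I
(`SaturationLadderVertexGerm`: coordinates `θ = log₂(u,v,w) ∈ [0,1]³` of a universal spectral point, easy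
duality for real shapes, the vertex collar).  Cell `decomp-mm`, lens 1, gen 12.  Cut of record unchanged.

* LANDED GRADES, READ ON THE SPECTRUM, HYPOTHESIS-FREE: `expCollar` (Coppersmith–Winograd, `ExpSaturation`:
  `r ≤ 16·4^{1/(1−t)}`), `familyCollar` (the base-ladder frontier `θ_F = 2^{47/30}`, `saturationBase_family`),
  and the scale-free form `darkness_le`: **`Σθ − 2 ≤ s·θ₁ + 16·4^{1/s}·(1 − θ₂)` for every `s ∈ (0,1]`** —
  darkness is logarithmically small in the gap `1 − θ₂` relative to `θ₁`, uniformly down to the vertex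
  `(1,0,1)` (a CONICAL constraint at the vertex; the sibling's `far_logModulus` is the affine one at unit scale).
* `subexpSaturation_iff_collar` — **the crux IS a statement about the spectrum**: `SubexpSaturation ⟺` for
  every `c > 0`, eventually in `t`, some `r ≤ e^{c/(1−t)}` makes `θ₀ + tθ₁ + rθ₂ ≤ 1 + r` hold on all of
  `X(ℂ)` (`⟸`: rational perturbation of `(t,r)`, the rational dictionary, monotonicity in `t`).
* THE RESIDUAL, POINTWISE.  `mm_iff_spectral`, `far_iff_spectral`, `farTwo_iff_spectral` (logarithmic forms
  of the sibling's `mm_iff_squareRoof` / `roof_iff_saturated`), `squareFromTwo_iff_spectral`,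
  `tailDescentTwo_iff_spectral`; and the sufficient pointwise law `squareFromTwo_of_noFlatDarkPoint`: call a
  universal spectral point FLAT DARK if `2 < Σθ ≤ 3 − max_i θ_i`; under `ω(1,2,1) = 3` every dark point is
  flat (the three slot-permuted halfspaces), so **"X(ℂ) has no flat dark point" ⟹ `SquareFromTwo`**
  (a law STRONGER than the residual, recorded as its pointwise form, not as a replacement).

No new definitions, no named facts, no sorry.  Placement [cite: Strassen1988, Thm. 3.8]
[cite: CoppersmithWinograd1990, §8] [cite: LottiRomani1983, §1 (p. 173), Prop. 4.1]
[cite: AlmanLi2026, Proposition 4.2] [cite: AlmanLiPratt2026, Prop. 8.1].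
-/

set_option linter.dupNamespace false

noncomputable section

namespace Summit.MatrixMultiplication.MatrixMultiplication.Theorems.SaturationLadderVertexGermCrux

open Real (logb)
open Literature.Computability.AlgebraicComplexity
open Summit.MatrixMultiplication.MatrixMultiplication.Theses.SaturationLadder
open Summit.MatrixMultiplication.MatrixMultiplication.Theorems.SaturationLadderVertexGerm
open Summit.MatrixMultiplication.MatrixMultiplication.Theorems.SaturationLadderExpSaturation
  (omegaRect_mono' expSaturation_holds)
open Summit.MatrixMultiplication.MatrixMultiplication.Theorems.SaturationLadderFamilyConstant
  (saturationBase_family)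


/-! ## §1 The landed grades on the spectrum (hypothesis-free) -/

/-- **Coppersmith–Winograd collar** (`ExpSaturation`, landed): for every `t ∈ [0,1)` some
`r ∈ [1, 16·4^{1/(1−t)}]` puts `X(ℂ)` in the halfspace `θ₀ + t θ₁ + r θ₂ ≤ 1 + r`.
[cite: CoppersmithWinograd1990, §8] -/
theorem expCollar (t : ℝ) (ht0 : 0 ≤ t) (ht1 : t < 1) :
    ∃ r : ℝ, 1 ≤ r ∧ r ≤ 16 * (4 : ℝ) ^ (1 / (1 - t)) ∧
      ∀ F : SpectralMap ℂ, IsUniversalSpectralPoint ℂ F →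
        logb 2 (F (matMulTensor ℂ 2 1 1)) + t * logb 2 (F (matMulTensor ℂ 1 2 1)) +
            r * logb 2 (F (matMulTensor ℂ 1 1 2)) ≤ 1 + r := by
  obtain ⟨r, h1, h2, h3⟩ := expSaturation_holds t ht0 ht1
  exact ⟨r, h1, h2, fun F hF => halfspace_of_tight ht0 (by linarith) h3 hF⟩

/-- **Family collar** (the base-ladder frontier `θ_F = 2^{47/30}`, landed): `r ≤ C·θ_F^{1/(1−t)}` suffices.
[cite: AlmanDuanVassilevskaWilliamsXuXuZhou2025, Thm. 3.2, §3.4] -/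
theorem familyCollar :
    ∃ C : ℝ, ∀ t : ℝ, 0 ≤ t → t < 1 →
      ∃ r : ℝ, 1 ≤ r ∧ r ≤ C * ((2 : ℝ) ^ ((47 : ℝ) / 30)) ^ (1 / (1 - t)) ∧
        ∀ F : SpectralMap ℂ, IsUniversalSpectralPoint ℂ F →
          logb 2 (F (matMulTensor ℂ 2 1 1)) + t * logb 2 (F (matMulTensor ℂ 1 2 1)) +
              r * logb 2 (F (matMulTensor ℂ 1 1 2)) ≤ 1 + r := by
  obtain ⟨C, hC⟩ := saturationBase_family
  refine ⟨C, fun t ht0 ht1 => ?_⟩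
  obtain ⟨r, h1, h2, h3⟩ := hC t ht0 ht1
  exact ⟨r, h1, h2, fun F hF => halfspace_of_tight ht0 (by linarith) h3 hF⟩

/-- **Scale-free darkness modulus at the vertex**: for every universal spectral point and every
`s ∈ (0,1]`, `Σθ − 2 ≤ s·θ₁ + 16·4^{1/s}·(1 − θ₂)`; in particular relative darkness `(Σθ−2)/θ₁` is at most
`s + 16·4^{1/s}·(1−θ₂)/θ₁` — logarithmically small in the relative gap `(1−θ₂)/θ₁`, at EVERY scale.
[cite: CoppersmithWinograd1990, §8] -/
theorem darkness_le {F : SpectralMap ℂ} (hF : IsUniversalSpectralPoint ℂ F) {s : ℝ} (hs0 : 0 < s)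
    (hs1 : s ≤ 1) :
    logb 2 (F (matMulTensor ℂ 2 1 1)) + logb 2 (F (matMulTensor ℂ 1 2 1)) +
        logb 2 (F (matMulTensor ℂ 1 1 2)) - 2 ≤
      s * logb 2 (F (matMulTensor ℂ 1 2 1)) + 16 * (4 : ℝ) ^ (1 / s) * (1 - logb 2 (F (matMulTensor ℂ 1 1 2))) := by
  obtain ⟨r, h1, h2, h3⟩ := expCollar (1 - s) (by linarith) (by linarith)
  have h := h3 F hF
  have hθ2 : logb 2 (F (matMulTensor ℂ 1 1 2)) ≤ 1 := (theta_mem hF).2.2.2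
  have e : 1 - (1 - s) = s := by ring
  rw [e] at h2
  have hmono := mul_le_mul_of_nonneg_right h2 (sub_nonneg.2 hθ2)
  linarith

/-! ## §2 The crux `SubexpSaturation` IS a statement about the spectrum -/

/-- `SubexpSaturation ⟹` sub-exponential collars. [cite: Strassen1988, Thm. 3.8] -/
theorem collar_of_subexpSaturation (h : SubexpSaturation) (c : ℝ) (hc : 0 < c) :
    ∃ t₀ : ℝ, t₀ < 1 ∧ ∀ t : ℝ, t₀ ≤ t → t < 1 →
      ∃ r : ℝ, 1 ≤ r ∧ r ≤ Real.exp (c / (1 - t)) ∧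
        ∀ F : SpectralMap ℂ, IsUniversalSpectralPoint ℂ F →
          logb 2 (F (matMulTensor ℂ 2 1 1)) + t * logb 2 (F (matMulTensor ℂ 1 2 1)) +
              r * logb 2 (F (matMulTensor ℂ 1 1 2)) ≤ 1 + r := by
  obtain ⟨t₀, ht₀, H⟩ := h c hc
  refine ⟨max t₀ 0, max_lt ht₀ one_pos, fun t ht ht1 => ?_⟩
  obtain ⟨r, h1, h2, h3⟩ := H t ((le_max_left _ _).trans ht) ht1
  exact ⟨r, h1, h2, fun F hF => halfspace_of_tight ((le_max_right _ _).trans ht) (by linarith) h3 hF⟩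

/-- `e^{2u} + 1 ≤ e^{3u}` for `u ≥ log 2`. [folklore] -/
theorem exp_two_mul_add_one_le {u : ℝ} (hu : Real.log 2 ≤ u) :
    Real.exp (2 * u) + 1 ≤ Real.exp (3 * u) := by
  have hlog : 0 < Real.log 2 := Real.log_pos one_lt_two
  have h2 : (2 : ℝ) ≤ Real.exp u := by
    calc (2 : ℝ) = Real.exp (Real.log 2) := (Real.exp_log two_pos).symm
      _ ≤ Real.exp u := Real.exp_le_exp.2 hu
  have h1 : (1 : ℝ) ≤ Real.exp (2 * u) := by
    have := Real.add_one_le_exp (2 * u)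
    linarith
  have e : Real.exp (3 * u) = Real.exp (2 * u) * Real.exp u := by
    rw [← Real.exp_add]; congr 1; ring
  rw [e]
  nlinarith [mul_le_mul_of_nonneg_left h2 (Real.exp_pos (2 * u)).le]

/-- **Sub-exponential collars ⟹ `SubexpSaturation`**: given `t`, take a rational `t' ∈ (t, t + (1−t)/2]`
and the collar AT `t'`; round its `r` up to a rational `r' ∈ [r, r + 1)` with the same denominator (the
halfspace survives because `θ₂ ≤ 1`), convert by the rational dictionary, and come back to `t` by
monotonicity; the slack `e^{(2c/3)/(1−t)} + 1 ≤ e^{c/(1−t)}` holds once `1 − t ≤ c/(3 log 2)`.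
[cite: Strassen1988, Thm. 3.8] [cite: LottiRomani1983, §1 (p. 173)] -/
theorem subexpSaturation_of_collar
    (h : ∀ c : ℝ, 0 < c → ∃ t₀ : ℝ, t₀ < 1 ∧ ∀ t : ℝ, t₀ ≤ t → t < 1 →
      ∃ r : ℝ, 1 ≤ r ∧ r ≤ Real.exp (c / (1 - t)) ∧
        ∀ F : SpectralMap ℂ, IsUniversalSpectralPoint ℂ F →
          logb 2 (F (matMulTensor ℂ 2 1 1)) + t * logb 2 (F (matMulTensor ℂ 1 2 1)) +
              r * logb 2 (F (matMulTensor ℂ 1 1 2)) ≤ 1 + r) :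
    SubexpSaturation := by
  intro c hc
  obtain ⟨t₀, ht₀1, H⟩ := h (c / 3) (by positivity)
  have hlog : 0 < Real.log 2 := Real.log_pos one_lt_two
  have hlogne : Real.log 2 ≠ 0 := hlog.ne'
  set t₁ : ℝ := max (max t₀ 0) (1 - c / (3 * Real.log 2)) with ht₁_def
  have ht₁1 : t₁ < 1 := max_lt (max_lt ht₀1 one_pos) (by
    have : 0 < c / (3 * Real.log 2) := by positivity
    linarith)
  refine ⟨t₁, ht₁1, fun t ht ht1 => ?_⟩
  have ht0 : 0 ≤ t := le_trans (le_trans (le_max_right _ _) (le_max_left _ _)) ht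
  have htt₀ : t₀ ≤ t := le_trans (le_trans (le_max_left _ _) (le_max_left _ _)) ht
  have htc : 1 - c / (3 * Real.log 2) ≤ t := le_trans (le_max_right _ _) ht
  have h1t : 0 < 1 - t := by linarith
  -- a denominator `d` with `1/d ≤ (1 - t)/2`
  obtain ⟨d, hd⟩ := exists_nat_gt (2 / (1 - t))
  have h2t : 0 < 2 / (1 - t) := by positivity
  have hd0 : (0 : ℝ) < d := h2t.trans hd
  have hdne : (d : ℝ) ≠ 0 := hd0.ne'
  have hd1 : 1 ≤ d := Nat.succ_le_of_lt (Nat.cast_pos.1 hd0)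
  have hdinv : 1 / (d : ℝ) ≤ (1 - t) / 2 := by
    rw [div_lt_iff₀ h1t] at hd
    rw [div_le_iff₀ hd0]
    linarith
  -- the rational `t' = (⌊t d⌋ + 1)/d ∈ (t, t + 1/d]`
  set p : ℕ := ⌊t * d⌋₊ + 1 with hp_def
  have hpcast : (p : ℝ) = (⌊t * d⌋₊ : ℝ) + 1 := by rw [hp_def]; push_cast; ring
  have htp : t < (p : ℝ) / d := by
    rw [lt_div_iff₀ hd0, hpcast]; exact Nat.lt_floor_add_one _
  have hpt : (p : ℝ) / d ≤ t + 1 / d := by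
    rw [div_le_iff₀ hd0, hpcast]
    have e : (t + 1 / d) * d = t * d + 1 := by field_simp
    rw [e]
    have := Nat.floor_le (by positivity : 0 ≤ t * d)
    linarith
  have hp1 : (p : ℝ) / d < 1 := by linarith
  have hp0 : t₀ ≤ (p : ℝ) / d := htt₀.trans htp.le
  obtain ⟨r, hr1, hr2, hr3⟩ := H ((p : ℝ) / d) hp0 hp1
  -- the rational `r' = ⌈r d⌉/d ∈ [r, r + 1/d]`
  set s : ℕ := ⌈r * d⌉₊ with hs_def
  have hrs : r ≤ (s : ℝ) / d := by rw [le_div_iff₀ hd0]; exact Nat.le_ceil _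
  have hsr : (s : ℝ) / d ≤ r + 1 / d := by
    rw [div_le_iff₀ hd0]
    have e : (r + 1 / d) * d = r * d + 1 := by field_simp
    rw [e]
    exact (Nat.ceil_lt_add_one (by positivity : 0 ≤ r * d)).le
  -- the halfspace at `(t', r')` and its conversion
  have hhalf : ∀ F : SpectralMap ℂ, IsUniversalSpectralPoint ℂ F →
      logb 2 (F (matMulTensor ℂ 2 1 1)) + (p : ℝ) / d * logb 2 (F (matMulTensor ℂ 1 2 1)) +
          (s : ℝ) / d * logb 2 (F (matMulTensor ℂ 1 1 2)) ≤ 1 + (s : ℝ) / d := by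
    intro F hF
    have h0 := hr3 F hF
    have hθ2 : logb 2 (F (matMulTensor ℂ 1 1 2)) ≤ 1 := (theta_mem hF).2.2.2
    have hmono := mul_le_mul_of_nonneg_left hθ2 (sub_nonneg.2 hrs)
    linarith
  have htight := tight_of_halfspace_rat p s hd1 hhalf
  refine ⟨(s : ℝ) / d, hr1.trans hrs, ?_, ?_⟩
  · -- growth: `s/d ≤ r + 1 ≤ e^{(c/3)/(1−t')} + 1 ≤ e^{(2c/3)/(1−t)} + 1 ≤ e^{c/(1−t)}`
    have hu : Real.log 2 ≤ c / 3 / (1 - t) := by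
      rw [le_div_iff₀ h1t]
      have h' : 1 - t ≤ c / (3 * Real.log 2) := by linarith
      calc Real.log 2 * (1 - t) ≤ Real.log 2 * (c / (3 * Real.log 2)) :=
            mul_le_mul_of_nonneg_left h' hlog.le
        _ = c / 3 := by rw [mul_comm, div_mul_eq_mul_div, mul_div_mul_right _ _ hlogne]
    have h1t' : (1 - t) / 2 ≤ 1 - (p : ℝ) / d := by linarith
    have hexp1 : Real.exp (c / 3 / (1 - (p : ℝ) / d)) ≤ Real.exp (2 * (c / 3 / (1 - t))) := by
      rw [Real.exp_le_exp]
      have hc3 : 0 ≤ c / 3 := by positivity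
      calc c / 3 / (1 - (p : ℝ) / d) ≤ c / 3 / ((1 - t) / 2) :=
            div_le_div_of_nonneg_left hc3 (by positivity) h1t'
        _ = 2 * (c / 3 / (1 - t)) := by rw [div_div_eq_mul_div]; ring
    have hexp2 := exp_two_mul_add_one_le hu
    have e3 : 3 * (c / 3 / (1 - t)) = c / (1 - t) := by ring
    rw [e3] at hexp2
    have hd1' : 1 / (d : ℝ) ≤ 1 := by linarith
    linarith
  · calc omegaRect ℂ 1 t ((s : ℝ) / d) ≤ omegaRect ℂ 1 ((p : ℝ) / d) ((s : ℝ) / d) :=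
          omegaRect_mono' le_rfl htp.le le_rfl
      _ ≤ 1 + (s : ℝ) / d := htight

/-- **`SubexpSaturation` on the spectrum**: the crux stmt-MatrixMultiplication-25909 is EQUIVALENT to
"for every `c > 0`, eventually in `t < 1`, some `r ∈ [1, e^{c/(1−t)}]` puts the whole asymptotic spectrum
`X(ℂ)` in the halfspace `θ₀ + t θ₁ + r θ₂ ≤ 1 + r`" — sub-exponentially long vertex collars.
[cite: Strassen1988, Thm. 3.8] [cite: LottiRomani1983, §1 (p. 173)] -/
theorem subexpSaturation_iff_collar :
    SubexpSaturation ↔ ∀ c : ℝ, 0 < c → ∃ t₀ : ℝ, t₀ < 1 ∧ ∀ t : ℝ, t₀ ≤ t → t < 1 →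
      ∃ r : ℝ, 1 ≤ r ∧ r ≤ Real.exp (c / (1 - t)) ∧
        ∀ F : SpectralMap ℂ, IsUniversalSpectralPoint ℂ F →
          logb 2 (F (matMulTensor ℂ 2 1 1)) + t * logb 2 (F (matMulTensor ℂ 1 2 1)) +
              r * logb 2 (F (matMulTensor ℂ 1 1 2)) ≤ 1 + r :=
  ⟨collar_of_subexpSaturation, subexpSaturation_of_collar⟩

/-! ## §3 The residual, pointwise: flat dark points -/

/-- `ω = 2 ⟺` the spectrum lies in `Σθ ≤ 2` (logarithmic form of the sibling's `mm_iff_squareRoof`).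
[cite: AlmanLi2026, Proposition 4.2] -/
theorem mm_iff_spectral :
    _root_.MatrixMultiplication ↔ ∀ F : SpectralMap ℂ, IsUniversalSpectralPoint ℂ F →
      logb 2 (F (matMulTensor ℂ 2 1 1)) + logb 2 (F (matMulTensor ℂ 1 2 1)) +
          logb 2 (F (matMulTensor ℂ 1 1 2)) ≤ 2 := by
  rw [_root_.MatrixMultiplication_iff, ← omegaRect_one_one_one ℂ]
  have h2 : (2 : ℝ) ≤ omegaRect ℂ 1 1 1 := two_le_omegaRect_one_one ℂ 1
  have key := omegaRect_natShape_le_iff 1 1 1 2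
  simp only [Nat.cast_one, one_mul] at key
  rw [← key]
  exact ⟨fun h => h.le, fun h => le_antisymm h h2⟩

/-- Far saturation `ω(1,k,1) = k+1 ⟺` the spectrum lies in `θ₀ + k θ₁ + θ₂ ≤ k + 1` (`k ∈ ℕ`; logarithmic
form of the sibling's `roof_iff_saturated`). [cite: Strassen1988, Thm. 3.8] [cite: LottiRomani1983, Prop. 4.1] -/
theorem far_iff_spectral (k : ℕ) :
    omegaRect ℂ 1 k 1 = k + 1 ↔ ∀ F : SpectralMap ℂ, IsUniversalSpectralPoint ℂ F →
      logb 2 (F (matMulTensor ℂ 2 1 1)) + (k : ℝ) * logb 2 (F (matMulTensor ℂ 1 2 1)) +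
          logb 2 (F (matMulTensor ℂ 1 1 2)) ≤ k + 1 := by
  have hk : (k : ℝ) + 1 ≤ omegaRect ℂ 1 k 1 := add_one_le_omegaRect_one_mid_one ℂ k
  have key := omegaRect_natShape_le_iff 1 k 1 ((k : ℝ) + 1)
  simp only [Nat.cast_one, one_mul] at key
  rw [← key]
  exact ⟨fun h => h.le, fun h => le_antisymm h hk⟩

/-- `ω(1,2,1) = 3 ⟺` the spectrum lies in `θ₀ + 2θ₁ + θ₂ ≤ 3` — a halfspace whose boundary contains the
EDGE `{θ₁ = 1}` of the bright triangle. [cite: Strassen1988, Thm. 3.8] [cite: LottiRomani1983, Prop. 4.1] -/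
theorem farTwo_iff_spectral :
    omegaRect ℂ 1 2 1 = 3 ↔ ∀ F : SpectralMap ℂ, IsUniversalSpectralPoint ℂ F →
      logb 2 (F (matMulTensor ℂ 2 1 1)) + 2 * logb 2 (F (matMulTensor ℂ 1 2 1)) +
          logb 2 (F (matMulTensor ℂ 1 1 2)) ≤ 3 := by
  have hk : (3 : ℝ) ≤ omegaRect ℂ 1 2 1 := by
    have := add_one_le_omegaRect_one_mid_one ℂ 2; norm_num at this; exact this
  have key := omegaRect_natShape_le_iff 1 2 1 3
  simp only [Nat.cast_one, Nat.cast_ofNat, one_mul] at key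
  rw [← key]
  exact ⟨fun h => h.le, fun h => le_antisymm h hk⟩

/-- **`SquareFromTwo` on the spectrum**: `(∀ φ, θ₀ + 2θ₁ + θ₂ ≤ 3) → ∀ φ, Σθ ≤ 2` — a halfspace exposing an
EDGE of the bright triangle already forces the whole FACE. [cite: Strassen1988, Thm. 3.8] -/
theorem squareFromTwo_iff_spectral :
    SquareFromTwo ↔
      ((∀ F : SpectralMap ℂ, IsUniversalSpectralPoint ℂ F →
          logb 2 (F (matMulTensor ℂ 2 1 1)) + 2 * logb 2 (F (matMulTensor ℂ 1 2 1)) +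
              logb 2 (F (matMulTensor ℂ 1 1 2)) ≤ 3) →
        ∀ F : SpectralMap ℂ, IsUniversalSpectralPoint ℂ F →
          logb 2 (F (matMulTensor ℂ 2 1 1)) + logb 2 (F (matMulTensor ℂ 1 2 1)) +
              logb 2 (F (matMulTensor ℂ 1 1 2)) ≤ 2) :=
  imp_congr farTwo_iff_spectral mm_iff_spectral

/-- **`TailDescentTwo` on the spectrum**: some edge-halfspace of slope `k ≥ 3` forces the one of slope `2`.
[cite: Strassen1988, Thm. 3.8] -/
theorem tailDescentTwo_iff_spectral :
    TailDescentTwo ↔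
      ((∃ k : ℕ, 3 ≤ k ∧ ∀ F : SpectralMap ℂ, IsUniversalSpectralPoint ℂ F →
          logb 2 (F (matMulTensor ℂ 2 1 1)) + (k : ℝ) * logb 2 (F (matMulTensor ℂ 1 2 1)) +
              logb 2 (F (matMulTensor ℂ 1 1 2)) ≤ k + 1) →
        ∀ F : SpectralMap ℂ, IsUniversalSpectralPoint ℂ F →
          logb 2 (F (matMulTensor ℂ 2 1 1)) + 2 * logb 2 (F (matMulTensor ℂ 1 2 1)) +
              logb 2 (F (matMulTensor ℂ 1 1 2)) ≤ 3) :=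
  imp_congr (exists_congr fun k => and_congr Iff.rfl (far_iff_spectral k)) farTwo_iff_spectral

/-- **No flat dark point ⟹ `SquareFromTwo`.**  Call a universal spectral point FLAT DARK if
`2 < Σθ ≤ 3 − max_i θ_i`.  Under `ω(1,2,1) = 3` the three slot-permuted halfspaces `Σθ + θ_i ≤ 3` hold on the
spectrum (`ω(2,1,1) = ω(1,2,1) = ω(1,1,2)`), so every dark point would be flat: if `X(ℂ)` has no flat dark
point, `ω(1,2,1) = 3` forces `ω = 2`. [cite: Strassen1988, Thm. 3.8] -/
theorem squareFromTwo_of_noFlatDarkPoint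
    (h : ∀ F : SpectralMap ℂ, IsUniversalSpectralPoint ℂ F →
      logb 2 (F (matMulTensor ℂ 2 1 1)) + logb 2 (F (matMulTensor ℂ 1 2 1)) +
          logb 2 (F (matMulTensor ℂ 1 1 2)) ≤ 3 - logb 2 (F (matMulTensor ℂ 2 1 1)) →
      logb 2 (F (matMulTensor ℂ 2 1 1)) + logb 2 (F (matMulTensor ℂ 1 2 1)) +
          logb 2 (F (matMulTensor ℂ 1 1 2)) ≤ 3 - logb 2 (F (matMulTensor ℂ 1 2 1)) →
      logb 2 (F (matMulTensor ℂ 2 1 1)) + logb 2 (F (matMulTensor ℂ 1 2 1)) +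
          logb 2 (F (matMulTensor ℂ 1 1 2)) ≤ 3 - logb 2 (F (matMulTensor ℂ 1 1 2)) →
      logb 2 (F (matMulTensor ℂ 2 1 1)) + logb 2 (F (matMulTensor ℂ 1 2 1)) +
          logb 2 (F (matMulTensor ℂ 1 1 2)) ≤ 2) :
    SquareFromTwo := by
  intro hE
  rw [mm_iff_spectral]
  intro F hF
  have h112 : omegaRect ℂ 1 1 2 = 3 := by rw [omegaRect_rotate ℂ 1 1 2]; exact hE
  have h211 : omegaRect ℂ 2 1 1 = 3 := by rw [omegaRect_rotate ℂ 2 1 1]; exact h112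
  have g0 := linear_le_omegaRect hF zero_le_two zero_le_one zero_le_one
  have g1 := linear_le_omegaRect hF zero_le_one zero_le_two zero_le_one
  have g2 := linear_le_omegaRect hF zero_le_one zero_le_one zero_le_two
  rw [h211] at g0
  rw [hE] at g1
  rw [h112] at g2
  exact h F hF (by linarith) (by linarith) (by linarith)

end Summit.MatrixMultiplication.MatrixMultiplication.Theorems.SaturationLadderVertexGermCrux

end
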